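import Literature.Analysis.FunctionSpaces.SteinExtension
import Literature.Analysis.FunctionSpaces.SobolevDomainProofs
import Literature.Analysis.FunctionSpaces.WeakDerivInner
import HarnessLib

/-!
# Gluing Sobolev regularity over two open sets with a smooth partition

Analysis/FunctionSpaces support file. The sheaf property of weak derivatives and of the Sobolev
classes `W^{k,p}` (Evans, *PDE*, §5.2; Adams–Fournier, *Sobolev Spaces*, §3: membership in
`W^{k,p}(Ω)` is local, a partition of unity reassembles it), in the tree's vocabulary
(`HasWeakFDerivOn`, `MemSobolevDomain`), for **two** open sets:

* `IsGluingCutoff Ω₁ Ω₂ χ` (one `structure`, the datum): a globally smooth `χ` with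
  `(Ω₁ ∪ Ω₂) ∩ tsupport χ ⊆ Ω₁` and `(Ω₁ ∪ Ω₂) ∩ tsupport (1 − χ) ⊆ Ω₂`; then `χφ` resp. `(1−χ)φ` is a
  test function on `Ω₁` resp. `Ω₂` for every test function `φ` on `Ω₁ ∪ Ω₂`
  (`IsGluingCutoff.isTestFunctionOn_mul_left/right`);
* `HasWeakFDerivOn.glue` — weak derivatives `g₁` on `Ω₁` and `g₂` on `Ω₂` of the same `f` give the
  weak derivative `Ω₁.piecewise g₁ g₂` on `Ω₁ ∪ Ω₂` (on `Ω₁ ∩ Ω₂` the two agree a.e. by uniqueness,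
  `HasWeakFDerivOn.unique_holds`; the test function is split as `χφ + (1−χ)φ`);
* `MemSobolevDomain.glue` — `W^{k,p}(Ω₁) ∩ W^{k,p}(Ω₂) ⊂ W^{k,p}(Ω₁ ∪ Ω₂)`, induction on `k`;
* helpers: `memLp_restrict_union`, `locallyIntegrableOn_union_of_isOpen`.

Written for the regularity of weak Neumann solutions on the periodic cylinder
(`FluidPDE/PeriodicCylinderNeumann*`: interior piece and near-wall piece of the period cell).

## Mathlib / tree search

`lean search 'MemSobolevDomain.*(union|glue|sup)|HasWeakFDerivOn.*(union|glue)'` — nothing; tree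
has restriction (`MemSobolevDomain.mono_set_holds`), uniqueness (`HasWeakFDerivOn.unique_holds`),
a.e. congruence (`MemSobolevDomain.congr_ae`), products with test functions
(`IsTestFunctionOn.mul_contDiff`, `integrableOn_smul_of_tsupport_subset`). Mathlib:
`memLp_indicator_iff_restrict`, `Set.piecewise`, `setIntegral_eq_integral_of_forall_compl_eq_zero`,
`IsOpen.nhdsWithin_eq`, `IntegrableAtFilter.filter_mono`.

## References

* L. C. Evans, *Partial Differential Equations*, 2nd ed. (2010), §5.2.1–5.2.2. [Evans2010]
* R. A. Adams, J. J. F. Fournier, *Sobolev Spaces*, 2nd ed. (2003), §3.2–3.3 (localisation,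
  partitions of unity). [AdamsFournier2003]
-/

noncomputable section

open MeasureTheory Set Filter Topology TopologicalSpace Function
open scoped ENNReal NNReal ContDiff

namespace Literature.Analysis.FunctionSpaces

variable {E' : Type*} [NormedAddCommGroup E'] [InnerProductSpace ℝ E'] [FiniteDimensional ℝ E']
  [MeasurableSpace E'] [BorelSpace E'] {μ : Measure E'}
variable {F : Type*} [NormedAddCommGroup F] [NormedSpace ℝ F] [CompleteSpace F]

omit [NormedSpace ℝ F] [CompleteSpace F] in
/-- `L^p` on a union of two measurable sets from `L^p` on each. [folklore] -/
theorem memLp_restrict_union {α : Type*} [MeasurableSpace α] {ν : Measure α} {f : α → F} {p : ℝ≥0∞}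
    {s t : Set α} (hs : MeasurableSet s) (ht : MeasurableSet t) (h₁ : MemLp f p (ν.restrict s))
    (h₂ : MemLp f p (ν.restrict t)) : MemLp f p (ν.restrict (s ∪ t)) := by
  rw [← memLp_indicator_iff_restrict (hs.union ht)]
  have h₂' : MemLp f p (ν.restrict (t \ s)) := h₂.mono_measure (Measure.restrict_mono (fun x hx => hx.1) le_rfl)
  have e : (s ∪ t).indicator f = s.indicator f + (t \ s).indicator f := by
    funext x
    by_cases hx : x ∈ s <;> by_cases hx' : x ∈ t <;> simp [Set.indicator, hx, hx']
  rw [e]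
  exact ((memLp_indicator_iff_restrict hs).2 h₁).add ((memLp_indicator_iff_restrict (ht.diff hs)).2 h₂')

/-- **A smooth partition subordinate to two open sets**: the data of the gluing theorems — a
globally smooth `χ` with `Ω ∩ tsupport χ ⊆ Ω₁` and `Ω ∩ tsupport (1 − χ) ⊆ Ω₂`, where
`Ω = Ω₁ ∪ Ω₂`. [folklore] -/
structure IsGluingCutoff (Ω₁ Ω₂ : Opens E') (χ : E' → ℝ) : Prop where
  contDiff : ContDiff ℝ ∞ χ
  inter_tsupport_subset : ((Ω₁ ⊔ Ω₂ : Opens E') : Set E') ∩ tsupport χ ⊆ Ω₁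
  inter_tsupport_compl_subset : ((Ω₁ ⊔ Ω₂ : Opens E') : Set E') ∩ tsupport (fun x => 1 - χ x) ⊆ Ω₂

namespace IsGluingCutoff

variable {Ω₁ Ω₂ : Opens E'} {χ : E' → ℝ}

omit [FiniteDimensional ℝ E'] [MeasurableSpace E'] [BorelSpace E'] in
/-- `χφ` is a test function on `Ω₁` for a test function `φ` on `Ω₁ ∪ Ω₂`. [folklore] -/
theorem isTestFunctionOn_mul_left (h : IsGluingCutoff Ω₁ Ω₂ χ) {φ : E' → ℝ}
    (hφ : IsTestFunctionOn (Ω₁ ⊔ Ω₂) φ) : IsTestFunctionOn Ω₁ fun x => φ x * χ x := by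
  have h1 := hφ.mul_contDiff h.contDiff
  refine ⟨h1.contDiff, h1.hasCompactSupport, ?_⟩
  intro x hx
  have hxφ : x ∈ tsupport φ := tsupport_mul_subset_left hx
  have hxχ : x ∈ tsupport χ := tsupport_mul_subset_right hx
  exact h.inter_tsupport_subset ⟨hφ.tsupport_subset hxφ, hxχ⟩

omit [FiniteDimensional ℝ E'] [MeasurableSpace E'] [BorelSpace E'] in
/-- `(1 − χ)φ` is a test function on `Ω₂` for a test function `φ` on `Ω₁ ∪ Ω₂`. [folklore] -/
theorem isTestFunctionOn_mul_right (h : IsGluingCutoff Ω₁ Ω₂ χ) {φ : E' → ℝ}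
    (hφ : IsTestFunctionOn (Ω₁ ⊔ Ω₂) φ) : IsTestFunctionOn Ω₂ fun x => φ x * (1 - χ x) := by
  have h1 := hφ.mul_contDiff ((contDiff_const (c := (1 : ℝ))).sub h.contDiff)
  refine ⟨h1.contDiff, h1.hasCompactSupport, ?_⟩
  intro x hx
  have hxφ : x ∈ tsupport φ := tsupport_mul_subset_left hx
  have hxχ : x ∈ tsupport (fun x => 1 - χ x) := tsupport_mul_subset_right hx
  exact h.inter_tsupport_compl_subset ⟨hφ.tsupport_subset hxφ, hxχ⟩

end IsGluingCutoff

omit [InnerProductSpace ℝ E'] [FiniteDimensional ℝ E'] [BorelSpace E'] in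
/-- Local integrability on a union of two open sets. [folklore] -/
theorem locallyIntegrableOn_union_of_isOpen {G : Type*} [NormedAddCommGroup G] {f : E' → G} {s t : Set E'}
    (hs : IsOpen s) (ht : IsOpen t) (h₁ : LocallyIntegrableOn f s μ) (h₂ : LocallyIntegrableOn f t μ) :
    LocallyIntegrableOn f (s ∪ t) μ := by
  intro x hx
  have hle : 𝓝[s ∪ t] x ≤ 𝓝 x := nhdsWithin_le_nhds
  rcases hx with hx | hx
  · have h := h₁ x hx
    rw [hs.nhdsWithin_eq hx] at h
    exact h.filter_mono hle
  · have h := h₂ x hx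
    rw [ht.nhdsWithin_eq hx] at h
    exact h.filter_mono hle

omit [FiniteDimensional ℝ E'] [BorelSpace E'] [CompleteSpace F] in
/-- A locally integrable operator field applied to a fixed vector is locally integrable. [folklore] -/
theorem HasWeakDerivAlongAux.locallyIntegrableOn_apply {s : Set E'} {g : E' → E' →L[ℝ] F}
    (hg : LocallyIntegrableOn g s μ) (v : E') : LocallyIntegrableOn (fun x => g x v) s μ :=
  (ContinuousLinearMap.apply ℝ F v).locallyIntegrableOn_comp hg

open Classical in
/-- **Gluing weak derivatives**: if `g₁`, `g₂` are weak derivatives of `f` on `Ω₁`, `Ω₂` and a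
gluing cut-off exists, then the piecewise function `Ω₁.piecewise g₁ g₂` is a weak derivative of `f`
on `Ω₁ ∪ Ω₂` (on `Ω₁ ∩ Ω₂` the two derivatives agree a.e. by uniqueness). [folklore] -/
theorem HasWeakFDerivOn.glue {Ω₁ Ω₂ : Opens E'} {χ : E' → ℝ} (hχ : IsGluingCutoff Ω₁ Ω₂ χ)
    {f : E' → F} {g₁ g₂ : E' → E' →L[ℝ] F} (h₁ : HasWeakFDerivOn Ω₁ μ f g₁) (h₂ : HasWeakFDerivOn Ω₂ μ f g₂)
    [μ.IsAddHaarMeasure] :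
    HasWeakFDerivOn (Ω₁ ⊔ Ω₂) μ f ((Ω₁ : Set E').piecewise g₁ g₂) := by
  classical
  have hΩ₁m : MeasurableSet (Ω₁ : Set E') := Ω₁.isOpen.measurableSet
  have hΩ₂m : MeasurableSet (Ω₂ : Set E') := Ω₂.isOpen.measurableSet
  set g : E' → E' →L[ℝ] F := (Ω₁ : Set E').piecewise g₁ g₂ with hg
  -- `g = g₁` on `Ω₁`, `g = g₂` a.e. on `Ω₂`
  have hg1 : ∀ x ∈ (Ω₁ : Set E'), g x = g₁ x := fun x hx => Set.piecewise_eq_of_mem _ _ _ hx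
  have hg2 : g =ᵐ[μ.restrict Ω₂] g₂ := by
    -- on `Ω₁ ∩ Ω₂` by uniqueness, on `Ω₂ \ Ω₁` by definition
    have hu : g₁ =ᵐ[μ.restrict ((Ω₁ ⊓ Ω₂ : Opens E') : Set E')] g₂ :=
      HasWeakFDerivOn.unique_holds (HasWeakFDerivOn.mono_set_holds h₁ inf_le_left)
        (HasWeakFDerivOn.mono_set_holds h₂ inf_le_right)
    rw [Filter.EventuallyEq, ae_restrict_iff' hΩ₂m]
    rw [Filter.EventuallyEq, ae_restrict_iff' (Ω₁ ⊓ Ω₂).isOpen.measurableSet] at hu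
    filter_upwards [hu] with x hx hx2
    by_cases hx1 : x ∈ (Ω₁ : Set E')
    · rw [hg1 x hx1]; exact hx ⟨hx1, hx2⟩
    · exact Set.piecewise_eq_of_notMem _ _ _ hx1
  have hgli2 : LocallyIntegrableOn g (Ω₂ : Set E') μ := h₂.locallyIntegrableOn_deriv.congr hg2.symm
  have hgli1 : LocallyIntegrableOn g (Ω₁ : Set E') μ :=
    h₁.locallyIntegrableOn_deriv.congr (ae_restrict_of_forall_mem hΩ₁m fun x hx => (hg1 x hx).symm)
  have hli : LocallyIntegrableOn f ((Ω₁ ⊔ Ω₂ : Opens E') : Set E') μ := by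
    rw [Opens.coe_sup]
    exact locallyIntegrableOn_union_of_isOpen Ω₁.isOpen Ω₂.isOpen h₁.locallyIntegrableOn h₂.locallyIntegrableOn
  have hgli : LocallyIntegrableOn g ((Ω₁ ⊔ Ω₂ : Opens E') : Set E') μ := by
    rw [Opens.coe_sup]
    exact locallyIntegrableOn_union_of_isOpen Ω₁.isOpen Ω₂.isOpen hgli1 hgli2
  refine ⟨hli, hgli, fun φ v hφ => ?_⟩
  set Ω : Opens E' := Ω₁ ⊔ Ω₂ with hΩ
  have hΩm : MeasurableSet (Ω : Set E') := Ω.isOpen.measurableSet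
  have hφ₁ := hχ.isTestFunctionOn_mul_left hφ
  have hφ₂ := hχ.isTestFunctionOn_mul_right hφ
  -- set integrals of functions supported in an open subset
  have hmove : ∀ {U : Opens E'} (_ : U ≤ Ω) {Fn : E' → F} (_ : ∀ x ∉ (U : Set E'), Fn x = 0),
      ∫ x in (Ω : Set E'), Fn x ∂μ = ∫ x in (U : Set E'), Fn x ∂μ := fun {U} hU {Fn} hFn => by
    rw [setIntegral_eq_integral_of_forall_compl_eq_zero fun x hx => hFn x fun h => hx (hU h),
      setIntegral_eq_integral_of_forall_compl_eq_zero fun x hx => hFn x hx]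
  have hsupp₁ : ∀ (w : E' → F), ∀ x ∉ (Ω₁ : Set E'), (φ x * χ x) • w x = 0 := fun w x hx => by
    rw [image_eq_zero_of_notMem_tsupport fun h => hx (hφ₁.tsupport_subset h), zero_smul]
  have hsupp₂ : ∀ (w : E' → F), ∀ x ∉ (Ω₂ : Set E'), (φ x * (1 - χ x)) • w x = 0 := fun w x hx => by
    rw [image_eq_zero_of_notMem_tsupport fun h => hx (hφ₂.tsupport_subset h), zero_smul]
  have hsupp₁' : ∀ x ∉ (Ω₁ : Set E'), (fderiv ℝ (fun x => φ x * χ x) x v) • f x = 0 := fun x hx => by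
    rw [fderiv_of_notMem_tsupport ℝ fun h => hx (hφ₁.tsupport_subset h)]; simp
  have hsupp₂' : ∀ x ∉ (Ω₂ : Set E'), (fderiv ℝ (fun x => φ x * (1 - χ x)) x v) • f x = 0 := fun x hx => by
    rw [fderiv_of_notMem_tsupport ℝ fun h => hx (hφ₂.tsupport_subset h)]; simp
  -- the two weak identities, moved to `Ω`
  have e₁ : ∫ x in (Ω : Set E'), (fderiv ℝ (fun x => φ x * χ x) x v) • f x ∂μ =
      -∫ x in (Ω : Set E'), (φ x * χ x) • g x v ∂μ := by
    rw [hmove le_sup_left hsupp₁', hmove le_sup_left (hsupp₁ fun x => g x v), h₁.integral_fderiv_smul_eq _ v hφ₁]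
    congr 1
    exact setIntegral_congr_fun hΩ₁m fun x hx => by rw [hg1 x hx]
  have e₂ : ∫ x in (Ω : Set E'), (fderiv ℝ (fun x => φ x * (1 - χ x)) x v) • f x ∂μ =
      -∫ x in (Ω : Set E'), (φ x * (1 - χ x)) • g x v ∂μ := by
    rw [hmove le_sup_right hsupp₂', hmove le_sup_right (hsupp₂ fun x => g x v), h₂.integral_fderiv_smul_eq _ v hφ₂]
    congr 1
    refine integral_congr_ae ?_
    filter_upwards [hg2] with x hx
    rw [hx]
  -- split `φ = φχ + φ(1 − χ)`
  have hφd : Differentiable ℝ φ := hφ.contDiff.differentiable (by simp)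
  have hχd : Differentiable ℝ χ := hχ.contDiff.differentiable (by simp)
  have hsplit : ∀ x, fderiv ℝ φ x v = fderiv ℝ (fun x => φ x * χ x) x v + fderiv ℝ (fun x => φ x * (1 - χ x)) x v := by
    intro x
    have hsum : (fun x => φ x * χ x + φ x * (1 - χ x)) = φ := funext fun x => by ring
    have hd1 : DifferentiableAt ℝ (fun y => φ y * χ y) x := (hφd x).mul (hχd x)
    have hd2 : DifferentiableAt ℝ (fun y => φ y * (1 - χ y)) x := (hφd x).mul ((differentiableAt_const (1 : ℝ)).sub (hχd x))
    have h : fderiv ℝ (fun y => φ y * χ y + φ y * (1 - χ y)) x =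
        fderiv ℝ (fun y => φ y * χ y) x + fderiv ℝ (fun y => φ y * (1 - χ y)) x := fderiv_add hd1 hd2
    rw [hsum] at h
    rw [h, _root_.add_apply]
  -- integrability on `Ω`
  have I₁ : Integrable (fun x => (φ x * χ x) • g x v) (μ.restrict Ω) := by
    have := integrableOn_smul_of_tsupport_subset hφ₁.contDiff.continuous hφ₁.hasCompactSupport
      (hφ₁.tsupport_subset.trans (show (Ω₁ : Set E') ⊆ Ω from le_sup_left))
      (HasWeakDerivAlongAux.locallyIntegrableOn_apply hgli v)
    exact this
  have I₂ : Integrable (fun x => (φ x * (1 - χ x)) • g x v) (μ.restrict Ω) := by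
    have := integrableOn_smul_of_tsupport_subset hφ₂.contDiff.continuous hφ₂.hasCompactSupport
      (hφ₂.tsupport_subset.trans (show (Ω₂ : Set E') ⊆ Ω from le_sup_right))
      (HasWeakDerivAlongAux.locallyIntegrableOn_apply hgli v)
    exact this
  have I₁' : Integrable (fun x => (fderiv ℝ (fun x => φ x * χ x) x v) • f x) (μ.restrict Ω) :=
    integrableOn_smul_of_tsupport_subset ((hφ₁.contDiff.continuous_fderiv (by simp)).clm_apply continuous_const)
      ((hφ₁.hasCompactSupport.fderiv_apply (𝕜 := ℝ) v)) ((tsupport_fderiv_apply_subset ℝ v).trans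
        (hφ₁.tsupport_subset.trans (show (Ω₁ : Set E') ⊆ Ω from le_sup_left))) hli
  have I₂' : Integrable (fun x => (fderiv ℝ (fun x => φ x * (1 - χ x)) x v) • f x) (μ.restrict Ω) :=
    integrableOn_smul_of_tsupport_subset ((hφ₂.contDiff.continuous_fderiv (by simp)).clm_apply continuous_const)
      ((hφ₂.hasCompactSupport.fderiv_apply (𝕜 := ℝ) v)) ((tsupport_fderiv_apply_subset ℝ v).trans
        (hφ₂.tsupport_subset.trans (show (Ω₂ : Set E') ⊆ Ω from le_sup_right))) hli
  calc ∫ x in (Ω : Set E'), (fderiv ℝ φ x v) • f x ∂μ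
      = ∫ x in (Ω : Set E'), ((fderiv ℝ (fun x => φ x * χ x) x v) • f x +
          (fderiv ℝ (fun x => φ x * (1 - χ x)) x v) • f x) ∂μ :=
        integral_congr_ae (Eventually.of_forall fun x => by simp only [hsplit x, add_smul])
    _ = -∫ x in (Ω : Set E'), (φ x * χ x) • g x v ∂μ + -∫ x in (Ω : Set E'), (φ x * (1 - χ x)) • g x v ∂μ := by
        rw [integral_add I₁' I₂', e₁, e₂]
    _ = -∫ x in (Ω : Set E'), φ x • g x v ∂μ := by
        rw [← neg_add, ← integral_add I₁ I₂]
        congr 1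
        refine integral_congr_ae (Eventually.of_forall fun x => ?_)
        show (φ x * χ x) • g x v + (φ x * (1 - χ x)) • g x v = φ x • g x v
        rw [← add_smul]; congr 1; ring

open Classical in
/-- **Gluing Sobolev regularity**: `W^{k,p}(Ω₁) ∩ W^{k,p}(Ω₂) ⊂ W^{k,p}(Ω₁ ∪ Ω₂)` in the presence of
a gluing cut-off (induction on `k` with `HasWeakFDerivOn.glue`). [folklore] -/
theorem MemSobolevDomain.glue {Ω₁ Ω₂ : Opens E'} {χ : E' → ℝ} (hχ : IsGluingCutoff Ω₁ Ω₂ χ)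
    [μ.IsAddHaarMeasure] {p : ℝ≥0∞} :
    ∀ (k : ℕ) {f : E' → F}, MemSobolevDomain k p Ω₁ μ f → MemSobolevDomain k p Ω₂ μ f →
      MemSobolevDomain k p (Ω₁ ⊔ Ω₂) μ f := by
  classical
  intro k
  induction k with
  | zero =>
    intro f h₁ h₂
    rw [memSobolevDomain_zero_iff] at h₁ h₂ ⊢
    rw [Opens.coe_sup]
    exact memLp_restrict_union Ω₁.isOpen.measurableSet Ω₂.isOpen.measurableSet h₁ h₂
  | succ k ih =>
    intro f h₁ h₂
    obtain ⟨hm₁, g₁, hg₁, hc₁⟩ := h₁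
    obtain ⟨hm₂, g₂, hg₂, hc₂⟩ := h₂
    refine ⟨?_, (Ω₁ : Set E').piecewise g₁ g₂, hg₁.glue hχ hg₂, fun v => ih ?_ ?_⟩
    · rw [Opens.coe_sup]
      exact memLp_restrict_union Ω₁.isOpen.measurableSet Ω₂.isOpen.measurableSet hm₁ hm₂
    · refine (hc₁ v).congr_ae (ae_restrict_of_forall_mem Ω₁.isOpen.measurableSet fun x hx => ?_)
      show g₁ x v = (Ω₁ : Set E').piecewise g₁ g₂ x v
      rw [Set.piecewise_eq_of_mem _ _ _ hx]
    · have hu : g₁ =ᵐ[μ.restrict ((Ω₁ ⊓ Ω₂ : Opens E') : Set E')] g₂ :=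
        HasWeakFDerivOn.unique_holds (HasWeakFDerivOn.mono_set_holds hg₁ inf_le_left)
          (HasWeakFDerivOn.mono_set_holds hg₂ inf_le_right)
      refine (hc₂ v).congr_ae ?_
      rw [Filter.EventuallyEq, ae_restrict_iff' Ω₂.isOpen.measurableSet]
      rw [Filter.EventuallyEq, ae_restrict_iff' (Ω₁ ⊓ Ω₂).isOpen.measurableSet] at hu
      filter_upwards [hu] with x hx hx2
      show g₂ x v = (Ω₁ : Set E').piecewise g₁ g₂ x v
      by_cases hx1 : x ∈ (Ω₁ : Set E')
      · rw [Set.piecewise_eq_of_mem _ _ _ hx1]; exact (congrArg (fun T : E' →L[ℝ] F => T v) (hx ⟨hx1, hx2⟩)).symm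
      · rw [Set.piecewise_eq_of_notMem _ _ _ hx1]

end Literature.Analysis.FunctionSpaces
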